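import Literature.Analysis.FunctionSpaces.TorusTrigPoly
import Literature.Analysis.FunctionSpaces.TorusRieszFischerParam
import Mathlib.MeasureTheory.Function.ContinuousMapDense
import HarnessLib

/-!
# The Riemann–Lebesgue lemma on the torus `𝕋^d`

For an integrable `f : 𝕋^d → ℂ` (`𝕋^d = UnitAddTorus d = (ℝ/ℤ)^d` with its Haar probability
measure, H21's global `volume`), the Fourier coefficients `𝓕f(x) = ∫ e_{-x} f` tend to `0` as
`|x| → ∞` (i.e. along the cofinite filter of `ℤ^d`): Grafakos, Prop. 3.3.1 (Riemann–Lebesgue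
lemma: "Given a function `f` in `L¹(𝐓ⁿ)`, we have that `|f̂(m)| → 0` as `|m| → ∞`"; 2nd ed. 2008,
p. 205, same numbering in the 3rd ed.). Mathlib has the Riemann–Lebesgue lemma
for the Fourier transform on inner-product spaces (`tendsto_integral_exp_inner_smul_cocompact`)
but not for Fourier coefficients on `AddCircle`/`UnitAddTorus`; the proof here is the textbook
one: approximate `f` in `L¹` by a continuous `g` (`Integrable.exists_boundedContinuous_integral_sub_le`,
the torus being compact metrisable), approximate `g` uniformly by a trigonometric polynomial `P`
(Stone–Weierstrass, Mathlib's `UnitAddTorus.span_mFourier_closure_eq_top`), and use that `𝓕P`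
has finite support while `|𝓕(f - P)(x)| ≤ ‖f - P‖₁`.

## References

* L. Grafakos, *Classical Fourier Analysis* (2nd ed. 2008 / 3rd ed. 2014), Prop. 3.3.1
  (Riemann–Lebesgue lemma on `𝐓ⁿ`; 2nd ed. p. 205), Prop. 3.2.1 and Cor. 3.2.2 (density of
  trigonometric polynomials in `L^p(𝐓ⁿ)`, `p < ∞`, and in `C(𝐓ⁿ)`; 2nd ed. p. 197) [Grafakos2014].
-/

noncomputable section

namespace Literature.Analysis.Fourier

open MeasureTheory Filter Topology UnitAddTorus
open Literature.Analysis.FunctionSpaces Literature.Analysis.FunctionSpaces.Torus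

variable {d : Type*} [Fintype d]

/-- `|e_n(t)| = 1`, hence `|𝓕f(x)| ≤ ‖f‖₁` (global volume). [folklore] -/
theorem norm_mFourierCoeff_le_integral_norm (f : UnitAddTorus d → ℂ) (x : d → ℤ) :
    ‖mFourierCoeff f x‖ ≤ ∫ t, ‖f t‖ := by
  rw [mFourierCoeff_eq_integral_volume]
  refine (norm_integral_le_integral_norm _).trans (le_of_eq ?_)
  refine integral_congr_ae (ae_of_all _ fun t => ?_)
  show ‖mFourier (-x) t • f t‖ = ‖f t‖
  rw [smul_eq_mul, norm_mul, norm_mFourier_apply, one_mul]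

/-- `𝓕` is subtractive on integrable functions (global volume). [folklore] -/
theorem mFourierCoeff_sub {f g : UnitAddTorus d → ℂ} (hf : Integrable f) (hg : Integrable g)
    (x : d → ℤ) : mFourierCoeff (fun t => f t - g t) x = mFourierCoeff f x - mFourierCoeff g x := by
  rw [mFourierCoeff_eq_integral_volume, mFourierCoeff_eq_integral_volume,
    mFourierCoeff_eq_integral_volume, ← integral_sub]
  · simp_rw [smul_sub]
  · simp_rw [smul_eq_mul]
    exact Integrable.bdd_mul (c := 1) hf (mFourier (-x)).continuous.aestronglyMeasurable
      (ae_of_all _ fun t => (norm_mFourier_apply _ _).le)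
  · simp_rw [smul_eq_mul]
    exact Integrable.bdd_mul (c := 1) hg (mFourier (-x)).continuous.aestronglyMeasurable
      (ae_of_all _ fun t => (norm_mFourier_apply _ _).le)

/-- A finite linear combination of characters, as a continuous map, is the trigonometric
polynomial `trigPoly` of the tree with the same coefficients. [folklore] -/
theorem coe_finsupp_sum_mFourier (c : (d → ℤ) →₀ ℂ) :
    (⇑(c.sum fun n a => a • mFourier n) : UnitAddTorus d → ℂ) = trigPoly c.support ⇑c := by
  funext t
  rw [trigPoly_apply, Finsupp.sum, ContinuousMap.coe_sum, Finset.sum_apply]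
  refine Finset.sum_congr rfl fun n _ => ?_
  rw [ContinuousMap.coe_smul, Pi.smul_apply, smul_eq_mul, smul_eq_mul, mul_comm]

/-- **Riemann–Lebesgue lemma on `𝕋^d`** (Grafakos 2014, Prop. 3.3.1): the Fourier coefficients of
an integrable function tend to zero at infinity, `𝓕f(x) → 0` along the cofinite filter of `ℤ^d`.
[cite: Grafakos2014, Prop. 3.3.1] -/
theorem tendsto_mFourierCoeff_cofinite {f : UnitAddTorus d → ℂ} (hf : Integrable f) :
    Tendsto (fun x : d → ℤ => mFourierCoeff f x) cofinite (𝓝 0) := by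
  classical
  rw [Metric.tendsto_nhds]
  intro ε hε
  -- Step 1: `L¹`-approximation by a continuous function
  obtain ⟨g, hfg, hgi⟩ := hf.exists_boundedContinuous_integral_sub_le (half_pos (half_pos hε))
  -- Step 2: uniform approximation of `g` by a trigonometric polynomial
  have hmem : (g.toContinuousMap : C(UnitAddTorus d, ℂ)) ∈
      (Submodule.span ℂ (Set.range (mFourier (d := d)))).topologicalClosure := by
    rw [span_mFourier_closure_eq_top]; trivial
  rw [← SetLike.mem_coe, Submodule.topologicalClosure_coe, Metric.mem_closure_iff] at hmem
  obtain ⟨P, hP, hgP⟩ := hmem (ε / 2 / 2) (half_pos (half_pos hε))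
  obtain ⟨c, rfl⟩ := Finsupp.mem_span_range_iff_exists_finsupp.1 hP
  -- the spectrum of `P` is `c.support`; off it, `|𝓕f(x)| ≤ ‖f - g‖₁ + ‖g - P‖₁ < ε`
  rw [Filter.eventually_cofinite]
  refine (c.support.finite_toSet).subset fun x hx => ?_
  rw [Set.mem_setOf_eq, dist_zero_right, not_lt] at hx
  by_contra hxc
  have hxc' : x ∉ c.support := fun h => hxc (Finset.mem_coe.2 h)
  -- `𝓕P(x) = 0`
  set Pf : UnitAddTorus d → ℂ := ⇑(c.sum fun n a => a • mFourier n) with hPf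
  have hPc : Continuous Pf := (c.sum fun n a => a • mFourier n).continuous
  have hP0 : mFourierCoeff Pf x = 0 := by
    rw [hPf, coe_finsupp_sum_mFourier, mFourierCoeff_trigPoly, if_neg hxc']
  -- `L¹` distances
  have hgc : Continuous (⇑g : UnitAddTorus d → ℂ) := g.continuous
  have hgPsup : ∀ t, ‖g t - Pf t‖ ≤ ε / 2 / 2 := by
    intro t
    have h1 : ‖g.toContinuousMap - c.sum fun n a => a • mFourier n‖ < ε / 2 / 2 := by
      rwa [← dist_eq_norm]
    exact ((g.toContinuousMap - c.sum fun n a => a • mFourier n).norm_coe_le_norm t).trans h1.le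
  have hgP1 : ∫ t, ‖g t - Pf t‖ ≤ ε / 2 / 2 := by
    calc ∫ t, ‖g t - Pf t‖ ≤ ∫ _t : UnitAddTorus d, ε / 2 / 2 :=
          integral_mono ((hgc.sub hPc).norm.integrable_unitAddTorus) (integrable_const _)
            fun t => hgPsup t
      _ = ε / 2 / 2 := by simp
  have hfP : ∫ t, ‖f t - Pf t‖ ≤ ε / 2 := by
    have hpt : ∀ t, ‖f t - Pf t‖ ≤ ‖f t - g t‖ + ‖g t - Pf t‖ := fun t => by
      calc ‖f t - Pf t‖ = ‖(f t - g t) + (g t - Pf t)‖ := by rw [sub_add_sub_cancel]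
        _ ≤ ‖f t - g t‖ + ‖g t - Pf t‖ := norm_add_le _ _
    calc ∫ t, ‖f t - Pf t‖ ≤ ∫ t, (‖f t - g t‖ + ‖g t - Pf t‖) :=
          integral_mono (hf.sub hPc.integrable_unitAddTorus).norm
            ((hf.sub hgi).norm.add (hgc.sub hPc).norm.integrable_unitAddTorus) hpt
      _ = (∫ t, ‖f t - g t‖) + ∫ t, ‖g t - Pf t‖ :=
          integral_add (hf.sub hgi).norm (hgc.sub hPc).norm.integrable_unitAddTorus
      _ ≤ ε / 2 / 2 + ε / 2 / 2 := add_le_add hfg hgP1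
      _ = ε / 2 := by ring
  -- conclusion
  have hbound : ‖mFourierCoeff f x‖ ≤ ε / 2 := by
    have h := mFourierCoeff_sub hf hPc.integrable_unitAddTorus x
    rw [hP0, sub_zero] at h
    rw [← h]
    exact (norm_mFourierCoeff_le_integral_norm _ x).trans hfP
  linarith

end Literature.Analysis.Fourier

end
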